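import Summits.AtomisticToContinuum.HydrodynamicLimit.Theses.CollisionIsometryCLT
import Summits.AtomisticToContinuum.HydrodynamicLimit.Theses.StiffCollisionalRelaxation
import Literature.Analysis.FluidPDE.HardSphereCollisionRecord

/-!
# Line `contact-chaos-by-row-orthogonality` for the crux `CollisionalTransferLocality`
(stmt-AtomisticToContinuum-9518; rank 4 of route `CollisionIsometryCLT`, K2 = rank 3 of
`StiffCollisionalRelaxation`, the two decls are `rfl`-equal)

The crux: under the local Gibbs law at fixed small reduced density `σ`, w.h.p. and uniformly in
`τ ≤ t`, the exact Irving–Kirkwood collisional residual `Cc(τ)` of the `(ψ, χ)`-tested momentum +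
energy balance equals `∫₀^τ∫ (div ψ + ∇χ·ū) p_c(ρ̄, θ̄)`, `p_c = hsPressure σ ρ θ − ρθ`.

## The line (idea card `contact-chaos-by-row-orthogonality`, merged per triage r1-1/2/3 with the
## split of `hemisphere-affine-slaving`; this file keeps card 4's ENGINE for the chaos leg)

Collision by collision (stub_balance), `Cc(τ) = (N+1)⁻¹ Σ_{ordered contact pairs (i,j), s_c ≤ τ}
[ψ(x_i)·Δv_i + χ(x_i) Δ(|v_i|²/2)]`, `Δv_i = |g·ω| ω`, `Δ(|v_i|²/2) = |g·ω| (V·ω)`. The Enskog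
hemisphere identities `∫_{g·ω<0}(g·ω)² ω⊗ω dω = (2π/15)(|g|²𝟙 + 2g⊗g)`,
`∫_{g·ω<0}(g·ω)²(V·ω) ω dω = (2π/15)(|g|²V + 2(g·V)g)` make the `|g·ω|`-weighted average of the
collision marks under ANY product (chaotic) pair law an AFFINE function of the local one-body moments:
per unit of dynamical collisional pressure `p_N := (N+1)⁻¹ Σ_ordered (ε/6)|g·ω| δ_{(s_c,x_c)}` the
transfer is `(div ψ + ū·∇χ) + (2/5)(D:∇ψ + Dū·∇χ)/(ρ̄θ̄) + (3/5) q·∇χ/(ρ̄θ̄)` (`D`, `q` = the block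
traceless kinetic stress and kinetic heat flux of the target `FastMomentRelaxation`, stmt-9522).
Hence  9518 ⟸ [A] moment chaos at contact (stub_contactPairCLT: `Jfun ≈ Sfun`)
            ∧ [B] thermodynamic contact value (stub_contactValue: `p_N ≈ p_c(ρ̄,θ̄) ds dx`)
            ∧ [C] `(Z−1)`-weighted weak kinetic relaxation (stub_weightedRelaxation, in-route from
                  9522 ∧ 9519 ∧ 9526 by Cauchy–Schwarz)
            ∧ bookkeeping (stub_balance, stub_reduction).
Card 4's lever is the ENGINE for [A]: the frozen-geometry velocity transfer `M` of the route is a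
linear isometry, so its rows are orthonormal INCLUDING the cross blocks, `Σ_k M_ik M_jkᵀ = δ_ij 𝟙₃`
(stub_rowOrthonormality, provable now); the pair `(v_i, v_j)(s_c⁻)` of a colliding pair is a pair of
mutually orthogonal isometric sums of the time-`(s_c − Δ_N)` velocities, and stub_contactPairCLT is
the route's adapted-weight CLT (crux 12949) run for the TWO rows of colliding pairs: row
delocalisation (the conclusion of crux 12950 `DiffuseBackwardInfluence`, by name) + time-averaged
exponential velocity moments and the density window (crux 9519 `AprioriBounds`, by name) ⟹ [A].

## Composition (kernel-checked, sorry-free; `_twin_of` concludes the `StiffCollisionalRelaxation` copy)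
`CollisionalTransferLocality_of : FastMomentRelaxation → DiffuseBackwardInfluence → AprioriBounds →
HsFreeEnergyConvex → stub_rowOrthonormality → stub_balance → stub_contactPairCLT → stub_contactValue →
stub_weightedRelaxation → stub_reduction → CollisionIsometryCLT.CollisionalTransferLocality` — the
four route items enter BY NAME (registered obligations of the same route; the line docks the crux
onto the route's own kinetic engine, as the idea card claims), the six `Holds.stub_*` are the
registered stubs (D-0027 §3.3 shape: `def stub_x : Prop := type_of% Holds.stub_x`).
`σ₀ := min(σ_9522, σ_12950, σ_9519, σ_[A], σ_[B], 1/2)`; the crux's `let`-telescope is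
`ConclusionAtFlow` verbatim, closed by `exact`.

Disproof used (`Cruxes/CollisionalTransferLocality/Disproof.lean`, cdisprove cycle 1, NO KILL, no
`_false_without_` theorem): §1 (Cc IS the collision-jump sum on the good set — stub_balance is that
statement for time-dependent tests; the crux "stands alone" w.r.t. empty/jammed cells — here the
density window is consumed explicitly, from `AprioriBounds` by name, by stubs [A] [B] [C]); §2
(normalisation: trace of the collisional stress = `3 p_c`, virial `Σ ε|g·ω|/3` — the factor `ε/6`
per ORDERED pair in `Sfun`); §3 (`σ = 0`: both sides vanish — consistent: `Sfun`, `Rhs`, `Kfun` are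
all `O(σ³)`); §4 `EquilibriumRung` (at the invariant law [A], [B] hold and `D = q = 0`). Landed
Negative lemmas (`Theorems/CollisionalTransferLocality/Negative/DegenerateProfiles.lean`, p73372):
degenerate-profile vacuity facts only; no stub is an instance they refute.
-/

namespace Summit.AtomisticToContinuum.HydrodynamicLimit.Cruxes.CollisionalTransferLocality.ContactChaosByRowOrthogonality

open scoped BigOperators Topology Manifold Classical MeasureTheory ProbabilityTheory Matrix InnerProductSpace ComplexConjugate ContinuousMap ENNReal
open Filter Set Function TopologicalSpace MeasureTheory

noncomputable section

/-! ## Types and the crux's hypotheses -/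

/-- Macroscopic torus. -/
abbrev T3 : Type := UnitAddTorus (Fin 3)
/-- Velocity space. -/
abbrev V3 : Type := EuclideanSpace ℝ (Fin 3)
/-- Phase space of `N + 1` spheres on `𝕋³` (the crux's configuration type). -/
abbrev Cfg (N : ℕ) : Type :=
  Literature.Analysis.FluidPDE.Config (N + 1) (Fin 3) (UnitAddTorus (Fin 3))
/-- Families of hard-sphere flows at reduced density `σ` (the crux's `Φ`). -/
abbrev Flows (σ : ℝ) : Type :=
  (N : ℕ) → Literature.Analysis.FluidPDE.HardSphereFlow
    (Literature.Analysis.FluidPDE.Torus.geometry (Fin 3))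
    (Literature.MathematicalPhysics.KineticTheory.hsDiameter σ N) (N + 1)

/-- Continuous positive profiles (the crux's hypotheses on `a₀, θ₀, u₀`). -/
def NiceProfiles (a₀ θ₀ : T3 → ℝ) (u₀ : T3 → V3) : Prop :=
  Continuous a₀ ∧ Continuous θ₀ ∧ Continuous u₀ ∧ (∀ x, 0 < a₀ x) ∧ (∀ x, 0 < θ₀ x)

/-- Admissible kernel family at mesoscale `(N+1)^{-γ}` (verbatim the crux's conjunction). -/
def AdmissibleKernel (γ C : ℝ) (φ : ℕ → T3 → ℝ) : Prop :=
  (∀ N, Literature.Analysis.FunctionSpaces.Torus.IsSmooth (φ N)) ∧ (∀ N y, 0 ≤ φ N y) ∧ (∀ N, ∫ y, φ N y = 1) ∧ (∀ (N : ℕ) y, ((N : ℝ) + 1) ^ (-γ) ≤ Literature.Analysis.FluidPDE.Torus.euclidDist y 0 → φ N y = 0) ∧ (∀ (N : ℕ) y, φ N y ≤ C * ((N : ℝ) + 1) ^ (3 * γ)) ∧ (∀ (N : ℕ) y, ‖Literature.Analysis.FunctionSpaces.Torus.gradient (φ N) y‖ ≤ C * ((N : ℝ) + 1) ^ (4 *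 γ))

/-! ## Block fields (verbatim bodies of the crux's / 9522's `let`s, as named definitions) -/

/-- Block density `ρ̄`. -/
def rhoB (φ : ℕ → T3 → ℝ) (N : ℕ) (z : Cfg N) (x : T3) : ℝ :=
  Literature.MathematicalPhysics.KineticTheory.empiricalDensityField z (fun y => φ N (y - x))
/-- Block momentum `m̄`. -/
def mB (φ : ℕ → T3 → ℝ) (N : ℕ) (z : Cfg N) (x : T3) : V3 :=
  Literature.MathematicalPhysics.KineticTheory.empiricalMomentumField z (fun y => φ N (y - x))
/-- Block energy `Ē`. -/
def EB (φ : ℕ → T3 → ℝ) (N : ℕ) (z : Cfg N) (x : T3) : ℝ :=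
  Literature.MathematicalPhysics.KineticTheory.empiricalEnergyField z (fun y => φ N (y - x))
/-- Block velocity `ū = m̄ / ρ̄` (junk `0` on empty blocks, as in the crux). -/
def uB (φ : ℕ → T3 → ℝ) (N : ℕ) (z : Cfg N) (x : T3) : V3 :=
  (rhoB φ N z x)⁻¹ • mB φ N z x
/-- Block temperature `θ̄ = (2/3)(Ē/ρ̄ − |m̄|²/(2ρ̄²))` (verbatim the crux's `θb`). -/
def thetaB (φ : ℕ → T3 → ℝ) (N : ℕ) (z : Cfg N) (x : T3) : ℝ :=
  2 / 3 * (EB φ N z x / rhoB φ N z x - ‖mB φ N z x‖ ^ 2 / (2 * rhoB φ N z x ^ 2))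
/-- Block kinetic pressure `ρ̄ θ̄` (one third of the trace of the block central kinetic stress). -/
def pkin (φ : ℕ → T3 → ℝ) (N : ℕ) (z : Cfg N) (x : T3) : ℝ :=
  rhoB φ N z x * thetaB φ N z x
/-- Collisional pressure `p_c(ρ, θ) = hsPressure σ ρ θ − ρθ = ρθ (Z(ρσ³) − 1)` (the crux's `pc`). -/
def pcoll (σ r th : ℝ) : ℝ :=
  Literature.MathematicalPhysics.KineticTheory.hsPressure σ r th - r * th
/-- Block traceless central kinetic stress `D_jk` (verbatim 9522's `D`, per unit volume). -/
def Dst (φ : ℕ → T3 → ℝ) (N : ℕ) (z : Cfg N) (x : T3) (j k : Fin 3) : ℝ :=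
  (∫ y, φ N (y.1 - x) * ((y.2 j - uB φ N z x j) * (y.2 k - uB φ N z x k))
      ∂(Literature.Analysis.FluidPDE.empiricalMeasure z)) -
    (if j = k then (∑ l : Fin 3, ∫ y, φ N (y.1 - x) * (y.2 l - uB φ N z x l) ^ 2
      ∂(Literature.Analysis.FluidPDE.empiricalMeasure z)) / 3 else 0)
/-- Block kinetic heat flux `q` (verbatim 9522's `q`, per unit volume). -/
def qfl (φ : ℕ → T3 → ℝ) (N : ℕ) (z : Cfg N) (x : T3) : V3 :=
  ∫ y, (φ N (y.1 - x) * ‖y.2 - uB φ N z x‖ ^ 2 / 2) • (y.2 - uB φ N z x)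
    ∂(Literature.Analysis.FluidPDE.empiricalMeasure z)

/-! ## Test-field weights -/

/-- `∂_b ψ_a (s, x)`. -/
def gradPsi (ψ : ℝ → T3 → V3) (s : ℝ) (x : T3) (a b : Fin 3) : ℝ :=
  Literature.Analysis.FunctionSpaces.Torus.gradient (fun y => ψ s y a) x b
/-- `∇χ (s, x)`. -/
def gradChi (χ : ℝ → T3 → ℝ) (s : ℝ) (x : T3) : V3 :=
  Literature.Analysis.FunctionSpaces.Torus.gradient (χ s) x
/-- `div ψ (s, x)`. -/
def divPsi (ψ : ℝ → T3 → V3) (s : ℝ) (x : T3) : ℝ :=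
  Literature.Analysis.FunctionSpaces.Torus.divergence (ψ s) x

/-- The EULER weight `div ψ + ∇χ·ū` (verbatim the crux's right-hand integrand before `p_c`). -/
def eulerW (ψ : ℝ → T3 → V3) (χ : ℝ → T3 → ℝ) (φ : ℕ → T3 → ℝ) (N : ℕ) (s : ℝ) (z : Cfg N)
    (x : T3) : ℝ :=
  divPsi ψ s x + ∑ j, gradChi χ s x j * uB φ N z x j

/-- The KINETIC-CORRECTION weight `(2/5)(D:∇ψ + (Dū)·∇χ)/(ρ̄θ̄) + (3/5) q·∇χ/(ρ̄θ̄)` — Enskog's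
universal factors `2/5`, `3/5` from the hemisphere identities; per unit collisional pressure this is
all the collisional transfer knows about the non-Maxwellian part of the local velocity law. -/
def kinW (ψ : ℝ → T3 → V3) (χ : ℝ → T3 → ℝ) (φ : ℕ → T3 → ℝ) (N : ℕ) (s : ℝ) (z : Cfg N)
    (x : T3) : ℝ :=
  2 / 5 * ((∑ a, ∑ b, Dst φ N z x a b * gradPsi ψ s x a b) +
      (∑ a, ∑ b, Dst φ N z x a b * uB φ N z x b * gradChi χ s x a)) / pkin φ N z x +
    3 / 5 * (∑ a, qfl φ N z x a * gradChi χ s x a) / pkin φ N z x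

/-! ## Collision side: jumps of an ordered contact pair, read off the post-collisional configuration -/

/-- Velocity jump `Δv_i = v_i⁺ − v_i⁻` of the FIRST partner of the ordered contact pair `(i, j)` of
the (post-collisional) configuration `w`; the incoming velocities are recovered by the elastic
involution `reflectVel` at the separation vector (as in `HardSphereCollisionRecord.ofConfig`).
At a genuine collision `Δv_i = |g·ω| ω`, `‖Δv_i‖ = |g·ω|`. -/
def dV (N : ℕ) (w : Cfg N) (i j : Fin (N + 1)) : V3 :=
  (w i).2 - (Literature.Analysis.FluidPDE.reflectVel
    ((Literature.Analysis.FluidPDE.Torus.geometry (Fin 3)).sepVec (w i).1 (w j).1)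
    ((w i).2, (w j).2)).1

/-- Kinetic-energy jump `Δ(|v_i|²/2)` of the first partner (`= |g·ω| (V·ω)` at a genuine collision,
`V` the centre-of-mass velocity of the pair). -/
def dE (N : ℕ) (w : Cfg N) (i j : Fin (N + 1)) : ℝ :=
  (‖(w i).2‖ ^ 2 - ‖(Literature.Analysis.FluidPDE.reflectVel
    ((Literature.Analysis.FluidPDE.Torus.geometry (Fin 3)).sepVec (w i).1 (w j).1)
    ((w i).2, (w j).2)).1‖ ^ 2) / 2

/-- JUMP KERNEL of the crux's observable: `ψ(s, x_i)·Δv_i + χ(s, x_i) Δ(|v_i|²/2)` (each particle of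
the pair counted once over the two orientations; summed over ordered pairs this is
`(ψ(x_i) − ψ(x_j))·Δv_i + (χ(x_i) − χ(x_j)) Δ(|v_i|²/2)` per collision). -/
def jumpK (ψ : ℝ → T3 → V3) (χ : ℝ → T3 → ℝ) (N : ℕ) (s : ℝ) (w : Cfg N) (i j : Fin (N + 1)) : ℝ :=
  inner ℝ (ψ s (w i).1) (dV N w i j) + χ s (w i).1 * dE N w i j

/-- SLAVED KERNEL: `(ε_N/6)·|g·ω|·[eulerW + kinW](s, x_i)` — the chaos-and-hemisphere average of the
jump kernel per ordered contact pair (`ε/2` per ordered pair × `1/3` from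
`∫(g·ω)₋² ω⊗ω / ∫(g·ω)₋² = 𝟙/3 + …`). -/
def slavedK (σ : ℝ) (ψ : ℝ → T3 → V3) (χ : ℝ → T3 → ℝ) (φ : ℕ → T3 → ℝ) (N : ℕ) (s : ℝ)
    (w : Cfg N) (i j : Fin (N + 1)) : ℝ :=
  Literature.MathematicalPhysics.KineticTheory.hsDiameter σ N / 6 * ‖dV N w i j‖ *
    (eulerW ψ χ φ N s w (w i).1 + kinW ψ χ φ N s w (w i).1)

/-- `J_N(z, τ)`: the normalised collision-jump sum over the ordered contact pairs of the orbit of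
`z` with collision times in `(0, τ]` (`HardSphereFlow.collisionPairSum`). -/
def Jfun (σ : ℝ) (Φ : Flows σ) (ψ : ℝ → T3 → V3) (χ : ℝ → T3 → ℝ) (N : ℕ) (z : Cfg N)
    (τ : ℝ) : ℝ :=
  ((N : ℝ) + 1)⁻¹ * (Φ N).collisionPairSum (Ioc 0 τ) (jumpK ψ χ N) z

/-- `S_N(z, τ)`: the slaved (chaos-averaged) collision sum `Σ_c (ε/6)|g·ω| [eulerW + kinW](s_c, x_c)`,
normalised by `(N+1)⁻¹`; its `eulerW`-part is the dynamical collisional pressure measure `p_N`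
tested against `div ψ + ū·∇χ`. -/
def Sfun (σ : ℝ) (Φ : Flows σ) (φ : ℕ → T3 → ℝ) (ψ : ℝ → T3 → V3) (χ : ℝ → T3 → ℝ) (N : ℕ)
    (z : Cfg N) (τ : ℝ) : ℝ :=
  ((N : ℝ) + 1)⁻¹ * (Φ N).collisionPairSum (Ioc 0 τ) (slavedK σ ψ χ φ N) z

/-- `Rhs_N(z, τ) = ∫₀^τ ∫ (div ψ + ∇χ·ū) p_c(ρ̄, θ̄)` — verbatim the crux's right-hand side. -/
def Rhs (σ : ℝ) (Φ : Flows σ) (φ : ℕ → T3 → ℝ) (ψ : ℝ → T3 → V3) (χ : ℝ → T3 → ℝ) (N : ℕ)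
    (z : Cfg N) (τ : ℝ) : ℝ :=
  ∫ s in Icc 0 τ, ∫ x, eulerW ψ χ φ N s ((Φ N).flow s z) x *
    pcoll σ (rhoB φ N ((Φ N).flow s z) x) (thetaB φ N ((Φ N).flow s z) x)

/-- `K_N(z, τ) = ∫₀^τ ∫ kinW · p_c(ρ̄, θ̄) = ∫₀^τ∫ (Z(ρ̄σ³) − 1)[(2/5)(D:∇ψ + Dū·∇χ) + (3/5)q·∇χ]`:
the `(Z−1)`-weighted weak kinetic functional. -/
def Kfun (σ : ℝ) (Φ : Flows σ) (φ : ℕ → T3 → ℝ) (ψ : ℝ → T3 → V3) (χ : ℝ → T3 → ℝ) (N : ℕ)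
    (z : Cfg N) (τ : ℝ) : ℝ :=
  ∫ s in Icc 0 τ, ∫ x, kinW ψ χ φ N s ((Φ N).flow s z) x *
    pcoll σ (rhoB φ N ((Φ N).flow s z) x) (thetaB φ N ((Φ N).flow s z) x)

/-! ## The crux's own functional `Cc` (verbatim) -/

/-- The tested observable `O(s, z) = ⟨μ_z, ψ_s·v + χ_s |v|²/2⟩` (verbatim the crux's `O`). -/
def Obs (ψ : ℝ → T3 → V3) (χ : ℝ → T3 → ℝ) (N : ℕ) (s : ℝ) (z : Cfg N) : ℝ :=
  ∫ y, ((∑ j, ψ s y.1 j * y.2 j) + χ s y.1 * (‖y.2‖ ^ 2 / 2))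
    ∂(Literature.Analysis.FluidPDE.empiricalMeasure z)

/-- The crux's collisional residual `Cc(τ)` (verbatim the crux's `Cc`, with `O := Obs ψ χ`). -/
def Cc (σ : ℝ) (Φ : Flows σ) (ψ : ℝ → T3 → V3) (χ : ℝ → T3 → ℝ) (N : ℕ) (z : Cfg N) (τ : ℝ) : ℝ :=
  Obs ψ χ N τ ((Φ N).flow τ z) - Obs ψ χ N 0 ((Φ N).flow 0 z) -
    ∫ s in Icc 0 τ, ((∫ y, ((∑ j, Literature.Analysis.FunctionSpaces.Torus.timeDeriv ψ s y.1 j * y.2 j) +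
      Literature.Analysis.FunctionSpaces.Torus.timeDeriv χ s y.1 * (‖y.2‖ ^ 2 / 2))
        ∂(Literature.Analysis.FluidPDE.empiricalMeasure ((Φ N).flow s z))) +
      deriv (fun r : ℝ => Obs ψ χ N s (Literature.Analysis.FluidPDE.freeFlight
        (Literature.Analysis.FluidPDE.Torus.geometry (Fin 3)) r ((Φ N).flow s z))) 0)

/-! ## The statements of the line -/

/-- **[S1] BALANCE IDENTITY** at `(σ, Φ)`: for every `N`, `t > 0`, smooth space–time tests on
`[0, t]`, every GOOD initial datum and every `τ ∈ [0, t]`, the crux's residual IS the normalised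
collision-jump sum over `(0, τ]`: `Cc(τ) = J_N(z, τ)` (weak balance law along the flow for
time-dependent tests: FTC on the free stretches, `O` jumps exactly by the pair's jump kernel). -/
def BalanceFor (σ : ℝ) (Φ : Flows σ) : Prop :=
  ∀ (N : ℕ) (t : ℝ), 0 < t → ∀ (ψ : ℝ → T3 → V3) (χ : ℝ → T3 → ℝ),
    Literature.Analysis.FunctionSpaces.Torus.IsSmoothSpaceTimeOn (Icc 0 t) ψ →
    Literature.Analysis.FunctionSpaces.Torus.IsSmoothSpaceTimeOn (Icc 0 t) χ →
    ∀ z ∈ (Φ N).good, ∀ τ ∈ Icc 0 t, Cc σ Φ ψ χ N z τ = Jfun σ Φ ψ χ N z τ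

/-- **[A] MOMENT CHAOS AT CONTACT** (slaved, self-normalised, Maxwellian-free form) at
`(σ, profiles, Φ, kernel, t, ψ, χ)`: uniformly in `τ ≤ t`, `J_N − S_N → 0` in local-Gibbs
probability — the `|g·ω|`-weighted empirical law of the collision marks `(ω, v⁻, v_*⁻)` is, block by
block, that of the flux-weighted PRODUCT of the block one-body velocity law (two Hoeffding
projections only: second moments and the mixed third moment). -/
def ChaosA (σ : ℝ) (a₀ θ₀ : T3 → ℝ) (u₀ : T3 → V3) (Φ : Flows σ) (φ : ℕ → T3 → ℝ) (t : ℝ)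
    (ψ : ℝ → T3 → V3) (χ : ℝ → T3 → ℝ) : Prop :=
  ∀ δ : ℝ, 0 < δ → Tendsto (fun N : ℕ =>
    Literature.MathematicalPhysics.KineticTheory.localGibbsLaw σ a₀ u₀ θ₀ N (Φ N)
      {z | ∃ τ ∈ Icc 0 t, δ < |Jfun σ Φ ψ χ N z τ - Sfun σ Φ φ ψ χ N z τ|}) atTop (𝓝 0)

/-- **[B] THERMODYNAMIC CONTACT VALUE** at `(σ, profiles, Φ, kernel, t, ψ, χ)`: uniformly in
`τ ≤ t`, `S_N − (Rhs_N + K_N) → 0` in probability — the dynamical collisional pressure measure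
`p_N(ds dx) = (N+1)⁻¹ Σ_ordered (ε/6)|g·ω| δ_{(s_c, x_c)}` equals `p_c(ρ̄, θ̄) ds dx` when tested
against the block-measurable weight `eulerW + kinW` (clock `= ρ̄² Y(ρ̄σ³)`-rate AND isotropy of the
de-fluxed contact normals, in one scalar statement). -/
def ValueB (σ : ℝ) (a₀ θ₀ : T3 → ℝ) (u₀ : T3 → V3) (Φ : Flows σ) (φ : ℕ → T3 → ℝ) (t : ℝ)
    (ψ : ℝ → T3 → V3) (χ : ℝ → T3 → ℝ) : Prop :=
  ∀ δ : ℝ, 0 < δ → Tendsto (fun N : ℕ =>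
    Literature.MathematicalPhysics.KineticTheory.localGibbsLaw σ a₀ u₀ θ₀ N (Φ N)
      {z | ∃ τ ∈ Icc 0 t, δ < |Sfun σ Φ φ ψ χ N z τ -
        (Rhs σ Φ φ ψ χ N z τ + Kfun σ Φ φ ψ χ N z τ)|}) atTop (𝓝 0)

/-- **[C] `(Z−1)`-WEIGHTED WEAK KINETIC RELAXATION** at `(σ, profiles, Φ, kernel, t, ψ, χ)`:
uniformly in `τ ≤ t`, `K_N → 0` in probability. -/
def RelaxC (σ : ℝ) (a₀ θ₀ : T3 → ℝ) (u₀ : T3 → V3) (Φ : Flows σ) (φ : ℕ → T3 → ℝ) (t : ℝ)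
    (ψ : ℝ → T3 → V3) (χ : ℝ → T3 → ℝ) : Prop :=
  ∀ δ : ℝ, 0 < δ → Tendsto (fun N : ℕ =>
    Literature.MathematicalPhysics.KineticTheory.localGibbsLaw σ a₀ u₀ θ₀ N (Φ N)
      {z | ∃ τ ∈ Icc 0 t, δ < |Kfun σ Φ φ ψ χ N z τ|}) atTop (𝓝 0)

/-! ## Inputs docked BY NAME from the route (verbatim tails of the route decls) -/

/-- The conclusion of the CRUX at `(σ, a₀, θ₀, u₀, Φ)`: verbatim the text of
`CollisionIsometryCLT.CollisionalTransferLocality` after `∀ Φ …,` (so that the composition closes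
by `exact`). -/
def ConclusionAtFlow (σ : ℝ) (a₀ θ₀ : T3 → ℝ) (u₀ : T3 → V3) (Φ : Flows σ) : Prop :=
  ∀ (γ C : ℝ) (φ : ℕ → (UnitAddTorus (Fin 3)) → ℝ), 0 < γ → γ ≤ 1 / 15 → ((∀ N, Literature.Analysis.FunctionSpaces.Torus.IsSmooth (φ N)) ∧ (∀ N y, 0 ≤ φ N y) ∧ (∀ N, ∫ y, φ N y = 1) ∧ (∀ (N : ℕ) y, ((N : ℝ) + 1) ^ (-γ) ≤ Literature.Analysis.FluidPDE.Torus.euclidDist y 0 → φ N y = 0) ∧ (∀ (N : ℕ) y, φ N y ≤ C * ((N : ℝ) + 1) ^ (3 * γ)) ∧ (∀ (N : ℕ) y, ‖Literature.Analysis.FunctionSpaces.Torus.gradient (φ N) y‖ ≤ C * ((N : ℝ) + 1) ^ (4 * γ))) → let ρb := fun (N : ℕ) (z : Literature.Analysis.FluidPDE.Config (N + 1) (Fin 3) (UnitAddTorus (Fin 3))) (x : (UnitAddTorus (Fin 3))) => Literature.MathematicalPhysics.KineticTheory.empiricalDensityField z (fun y => φ N (y - x)); let mb := fun (N : ℕ)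 (z : Literature.Analysis.FluidPDE.Config (N + 1) (Fin 3) (UnitAddTorus (Fin 3))) (x : (UnitAddTorus (Fin 3))) => Literature.MathematicalPhysics.KineticTheory.empiricalMomentumField z (fun y => φ N (y - x)); let Eb := fun (N : ℕ) (z : Literature.Analysis.FluidPDE.Config (N + 1) (Fin 3) (UnitAddTorus (Fin 3))) (x : (UnitAddTorus (Fin 3))) => Literature.MathematicalPhysics.KineticTheory.empiricalEnergyField z (fun y => φ N (y - x)); let ub := fun (N : ℕ) (z : Literature.Analysis.FluidPDE.Config (N + 1) (Fin 3) (UnitAddTorus (Fin 3))) (x : (UnitAddTorus (Fin 3))) => (ρb N z x)⁻¹ • mb N z x; let θb := fun (N : ℕ) (z : Literature.Analysis.FluidPDE.Config (N + 1) (Fin 3) (UnitAddTorus (Fin 3))) (x : (UnitAddTorus (Fin 3))) => 2 / 3 * (Eb N z x / ρb N z x - ‖mb N z x‖ ^ 2 / (2 * ρb N z x ^ 2)); let pc := fun (r th : ℝ) => Literature.MathematicalPhysics.KineticTheory.hsPressure σ r th - r * th; ∀ t : ℝ, 0 < t → ∀ (ψ : ℝ → (UnitAddTorus (Fin 3)) →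 (EuclideanSpace ℝ (Fin 3))) (χ : ℝ → (UnitAddTorus (Fin 3)) → ℝ), Literature.Analysis.FunctionSpaces.Torus.IsSmoothSpaceTimeOn (Icc 0 t) ψ → Literature.Analysis.FunctionSpaces.Torus.IsSmoothSpaceTimeOn (Icc 0 t) χ → let O := fun (N : ℕ) (s : ℝ) (z : Literature.Analysis.FluidPDE.Config (N + 1) (Fin 3) (UnitAddTorus (Fin 3))) => ∫ y, ((∑ j, ψ s y.1 j * y.2 j) + χ s y.1 * (‖y.2‖ ^ 2 / 2)) ∂(Literature.Analysis.FluidPDE.empiricalMeasure z); let Cc := fun (N : ℕ) (z : Literature.Analysis.FluidPDE.Config (N + 1) (Fin 3) (UnitAddTorus (Fin 3))) (τ : ℝ) => O N τ ((Φ N).flow τ z) - O N 0 ((Φ N).flow 0 z) - ∫ s in Icc 0 τ, ((∫ y, ((∑ j, Literature.Analysis.FunctionSpaces.Torus.timeDeriv ψ s y.1 j * y.2 j) + Literature.Analysis.FunctionSpaces.Torus.timeDeriv χ s y.1 * (‖y.2‖ ^ 2 / 2)) ∂(Literature.Analysis.FluidPDE.empiricalMeasure ((Φ N).flow s z))) +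 deriv (fun r : ℝ => O N s (Literature.Analysis.FluidPDE.freeFlight (Literature.Analysis.FluidPDE.Torus.geometry (Fin 3)) r ((Φ N).flow s z))) 0); ∀ δ : ℝ, 0 < δ → Tendsto (fun N : ℕ => Literature.MathematicalPhysics.KineticTheory.localGibbsLaw σ a₀ u₀ θ₀ N (Φ N) {z | ∃ τ ∈ Icc 0 t, δ < |Cc N z τ - ∫ s in Icc 0 τ, ∫ x, (Literature.Analysis.FunctionSpaces.Torus.divergence (ψ s) x + ∑ j, Literature.Analysis.FunctionSpaces.Torus.gradient (χ s) x j * ub N ((Φ N).flow s z) x j) * pc (ρb N ((Φ N).flow s z) x) (θb N ((Φ N).flow s z) x)|}) atTop (𝓝 0)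

/-- ROW DELOCALISATION at `(σ, a₀, θ₀, u₀)`: verbatim the conclusion of crux 12950
`DiffuseBackwardInfluence` after `σ < σ₀ →` (its `let M; let ipr` included). -/
def DelocAt (σ : ℝ) (a₀ θ₀ : T3 → ℝ) (u₀ : T3 → V3) : Prop :=
  let M := fun (N : ℕ) (y : Literature.Analysis.FluidPDE.Config (N + 1) (Fin 3) (UnitAddTorus (Fin 3))) (Δ : ℝ) (W : Fin (N + 1) → EuclideanSpace ℝ (Fin 3)) => (let G := Literature.Analysis.FluidPDE.Torus.geometry (Fin 3); let ε : ℝ := Literature.MathematicalPhysics.KineticTheory.hsDiameter σ N; let pre := fun k : ℕ => (let zk := Literature.Analysis.FluidPDE.Alexander.stateAfter G ε y k; Literature.Analysis.FluidPDE.freeFlight G (Literature.Analysis.FluidPDE.Alexander.freeExitTime G ε zk).toReal zk); (List.range (Literature.Analysis.FluidPDE.Alexander.collisionCount G ε y Δ)).foldl (fun W' k => @dite (Fin (N + 1) → EuclideanSpace ℝ (Fin 3)) (Literature.Analysis.FluidPDE.Alexander.incomingPairs G ε (pre k)).Nonempty (Classical.propDecidable _) (fun h => fun i => (Literature.Analysis.FluidPDE.collidePair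 G h.some.1 h.some.2 (fun j => ((pre k j).1, W' j)) i).2) (fun _ => W')) W); let ipr := fun N y Δ => ((N + 1 : ℕ) : ℝ)⁻¹ * ∑ i : Fin (N + 1), ∑ k : Fin (N + 1), (∑ a : Fin 3, ‖M N y Δ (Pi.single k (EuclideanSpace.single a (1 : ℝ))) i‖ ^ 2) ^ 2; ∀ Φ : (N : ℕ) → Literature.Analysis.FluidPDE.HardSphereFlow (Literature.Analysis.FluidPDE.Torus.geometry (Fin 3)) (Literature.MathematicalPhysics.KineticTheory.hsDiameter σ N) (N + 1), ∀ Δ : ℕ → ℝ, (∀ N, 0 < Δ N) → Tendsto Δ atTop (𝓝 0) → Tendsto (fun N : ℕ => Δ N * ((N + 1 : ℕ) : ℝ) ^ ((1 : ℝ) / 3)) atTop atTop → ∀ t : ℝ, 0 < t → Tendsto (fun N : ℕ => ∫⁻ z, ENNReal.ofReal (ipr N ((Φ N).flow (t - Δ N) z) (Δ N)) ∂(Literature.MathematicalPhysics.KineticTheory.localGibbsLaw σ a₀ u₀ θ₀ N (Φ N))) atTop (𝓝 0)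

/-- KINETIC CLOSURE at `(σ, a₀, θ₀, u₀)`: verbatim the conclusion of the target 9522
`FastMomentRelaxation` after `σ < σ₀ →`. -/
def FMRAt (σ : ℝ) (a₀ θ₀ : T3 → ℝ) (u₀ : T3 → V3) : Prop :=
  ∀ Φ : (N : ℕ) → Literature.Analysis.FluidPDE.HardSphereFlow (Literature.Analysis.FluidPDE.Torus.geometry (Fin 3)) (Literature.MathematicalPhysics.KineticTheory.hsDiameter σ N) (N + 1), ∀ (γ C : ℝ) (φ : ℕ → (UnitAddTorus (Fin 3)) → ℝ), 0 < γ → γ ≤ 1 / 15 → ((∀ N, Literature.Analysis.FunctionSpaces.Torus.IsSmooth (φ N)) ∧ (∀ N y, 0 ≤ φ N y) ∧ (∀ N, ∫ y, φ N y = 1) ∧ (∀ (N : ℕ) y, ((N : ℝ) + 1) ^ (-γ) ≤ Literature.Analysis.FluidPDE.Torus.euclidDist y 0 → φ N y = 0) ∧ (∀ (N : ℕ) y, φ N y ≤ C * ((N : ℝ) + 1) ^ (3 * γ)) ∧ (∀ (N : ℕ) y, ‖Literature.Analysis.FunctionSpaces.Torus.gradient (φ N) y‖ ≤ C * ((N :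 ℝ) + 1) ^ (4 * γ))) → let ρb := fun (N : ℕ) (z : Literature.Analysis.FluidPDE.Config (N + 1) (Fin 3) (UnitAddTorus (Fin 3))) (x : (UnitAddTorus (Fin 3))) => Literature.MathematicalPhysics.KineticTheory.empiricalDensityField z (fun y => φ N (y - x)); let mb := fun (N : ℕ) (z : Literature.Analysis.FluidPDE.Config (N + 1) (Fin 3) (UnitAddTorus (Fin 3))) (x : (UnitAddTorus (Fin 3))) => Literature.MathematicalPhysics.KineticTheory.empiricalMomentumField z (fun y => φ N (y - x)); let ub := fun (N : ℕ) (z : Literature.Analysis.FluidPDE.Config (N + 1) (Fin 3) (UnitAddTorus (Fin 3))) (x : (UnitAddTorus (Fin 3))) => (ρb N z x)⁻¹ • mb N z x; let D := fun (N : ℕ) (z : Literature.Analysis.FluidPDE.Config (N + 1) (Fin 3) (UnitAddTorus (Fin 3))) (x : (UnitAddTorus (Fin 3))) (j k : Fin 3) => (∫ y, φ N (y.1 - x) * ((y.2 j - ub N z x j) * (y.2 k - ub N z x k)) ∂(Literature.Analysis.FluidPDE.empiricalMeasure z)) - (if j = k then (∑ l : Fin 3, ∫ y, φ N (y.1 -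 x) * (y.2 l - ub N z x l) ^ 2 ∂(Literature.Analysis.FluidPDE.empiricalMeasure z)) / 3 else 0); let q := fun (N : ℕ) (z : Literature.Analysis.FluidPDE.Config (N + 1) (Fin 3) (UnitAddTorus (Fin 3))) (x : (UnitAddTorus (Fin 3))) => ∫ y, (φ N (y.1 - x) * ‖y.2 - ub N z x‖ ^ 2 / 2) • (y.2 - ub N z x) ∂(Literature.Analysis.FluidPDE.empiricalMeasure z); ∀ t : ℝ, 0 < t → ∀ δ : ℝ, 0 < δ → Tendsto (fun N : ℕ => Literature.MathematicalPhysics.KineticTheory.localGibbsLaw σ a₀ u₀ θ₀ N (Φ N) {z | δ < ∫ s in Icc 0 t, ∫ x, ((∑ j, ∑ k, D N ((Φ N).flow s z) x j k ^ 2) + ‖q N ((Φ N).flow s z) x‖ ^ 2)}) atTop (𝓝 0)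

/-- TIME-AVERAGED EXPONENTIAL VELOCITY MOMENT at `(σ, profiles, Φ, t)`: verbatim component (i) of
crux 9519 `AprioriBounds`. -/
def ExpMomAt (σ : ℝ) (a₀ θ₀ : T3 → ℝ) (u₀ : T3 → V3) (Φ : Flows σ) (t : ℝ) : Prop :=
  ∃ lam Cexp : ℝ, 0 < lam ∧ Tendsto (fun N : ℕ => Literature.MathematicalPhysics.KineticTheory.localGibbsLaw σ a₀ u₀ θ₀ N (Φ N) {z | Cexp < ∫ s in Icc 0 t, ∫ y, Real.exp (lam * ‖y.2‖ ^ 2) ∂(Literature.Analysis.FluidPDE.empiricalMeasure ((Φ N).flow s z))}) atTop (𝓝 0)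

/-- DENSITY WINDOW at `(σ, profiles, Φ, t, kernel)`: verbatim the conclusion of component (ii) of
crux 9519 `AprioriBounds` (`c₁ ≤ ρ̄`, `ρ̄σ³ ≤ 1` for all `s ≤ t` and `x`, w.h.p.). -/
def WindowAt (σ : ℝ) (a₀ θ₀ : T3 → ℝ) (u₀ : T3 → V3) (Φ : Flows σ) (t : ℝ)
    (φ : ℕ → T3 → ℝ) : Prop :=
  ∃ c₁ : ℝ, 0 < c₁ ∧ Tendsto (fun N : ℕ => Literature.MathematicalPhysics.KineticTheory.localGibbsLaw σ a₀ u₀ θ₀ N (Φ N) {z | ∃ s ∈ Icc 0 t, ∃ x : (UnitAddTorus (Fin 3)), Literature.MathematicalPhysics.KineticTheory.empiricalDensityField ((Φ N).flow s z) (fun y => φ N (y - x)) < c₁ ∨ 1 < Literature.MathematicalPhysics.KineticTheory.empiricalDensityField ((Φ N).flow s z) (fun y => φ N (y - x)) * σ ^ 3}) atTop (𝓝 0)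

/-- **ROW ORTHONORMALITY** of the frozen-geometry velocity transfer `M` (verbatim the route's
`let M` of cruxes 12949/12950 and support 12951): `Σ_k Σ_a (M(e_k⊗e_a))_{i,a'} (M(e_k⊗e_a))_{j,b'}
= δ_ij δ_{a'b'}` — `M Mᵀ = I` blockwise, the cross blocks `i ≠ j` included (card 4's first lemma;
finite-dimensional: additive + homogeneous + norm-preserving on `ℝ^{3(N+1)}` ⇒ orthogonal). -/
def RowOrthonormality (σ : ℝ) : Prop :=
  let M := fun (N : ℕ) (y : Literature.Analysis.FluidPDE.Config (N + 1) (Fin 3) (UnitAddTorus (Fin 3))) (Δ : ℝ) (W : Fin (N + 1) → EuclideanSpace ℝ (Fin 3)) => (let G := Literature.Analysis.FluidPDE.Torus.geometry (Fin 3); let ε : ℝ := Literature.MathematicalPhysics.KineticTheory.hsDiameter σ N; let pre := fun k : ℕ => (let zk := Literature.Analysis.FluidPDE.Alexander.stateAfter G ε y k; Literature.Analysis.FluidPDE.freeFlight G (Literature.Analysis.FluidPDE.Alexander.freeExitTime G ε zk).toReal zk); (List.range (Literature.Analysis.FluidPDE.Alexander.collisionCount G ε y Δ)).foldl (fun W'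 k => @dite (Fin (N + 1) → EuclideanSpace ℝ (Fin 3)) (Literature.Analysis.FluidPDE.Alexander.incomingPairs G ε (pre k)).Nonempty (Classical.propDecidable _) (fun h => fun i => (Literature.Analysis.FluidPDE.collidePair G h.some.1 h.some.2 (fun j => ((pre k j).1, W' j)) i).2) (fun _ => W')) W);
  ∀ (N : ℕ) (y : Literature.Analysis.FluidPDE.Config (N + 1) (Fin 3) (UnitAddTorus (Fin 3))) (Δ : ℝ)
    (i j : Fin (N + 1)) (a' b' : Fin 3),
    (∑ k : Fin (N + 1), ∑ a : Fin 3,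
        (M N y Δ (Pi.single k (EuclideanSpace.single a (1 : ℝ))) i) a' *
        (M N y Δ (Pi.single k (EuclideanSpace.single a (1 : ℝ))) j) b')
      = if i = j ∧ a' = b' then 1 else 0

/-- The crux's conclusion at `(σ, profiles, Φ)` UNFOLDED: its `let`-bound block fields, `pc`, `O`,
`Cc` and right-hand side are this file's `rhoB`, `thetaB`, `uB`, `pcoll`, `Obs`, `Cc`, `Rhs`
definitionally (`Iff.rfl`), and its kernel hypothesis is `AdmissibleKernel`. This is the form in
which `stub_reduction` delivers it. -/
theorem conclusionAtFlow_iff (σ : ℝ) (a₀ θ₀ : T3 → ℝ) (u₀ : T3 → V3) (Φ : Flows σ) :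
    ConclusionAtFlow σ a₀ θ₀ u₀ Φ ↔
      ∀ (γ C : ℝ) (φ : ℕ → T3 → ℝ), 0 < γ → γ ≤ 1 / 15 → AdmissibleKernel γ C φ →
        ∀ t : ℝ, 0 < t → ∀ (ψ : ℝ → T3 → V3) (χ : ℝ → T3 → ℝ),
          Literature.Analysis.FunctionSpaces.Torus.IsSmoothSpaceTimeOn (Icc 0 t) ψ →
          Literature.Analysis.FunctionSpaces.Torus.IsSmoothSpaceTimeOn (Icc 0 t) χ →
          ∀ δ : ℝ, 0 < δ → Tendsto (fun N : ℕ =>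
            Literature.MathematicalPhysics.KineticTheory.localGibbsLaw σ a₀ u₀ θ₀ N (Φ N)
              {z | ∃ τ ∈ Icc 0 t, δ < |Cc σ Φ ψ χ N z τ - Rhs σ Φ φ ψ χ N z τ|}) atTop (𝓝 0) :=
  Iff.rfl

/-! ## Registered stubs (`Holds.stub_*`, bodies `sorry`) -/

namespace Holds

/-- STUB 0 (ROW ORTHONORMALITY, M, provable now). Each fold step of `M` is the identity or the
reflection `[(1−P), P; P, (1−P)]`, `P = ν̂ν̂ᵀ`, on the two rows of the incoming pair — a linear
isometry of `(Fin (N+1) → V3)`; a linear isometry of a finite-dimensional inner-product space is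
orthogonal, `MᵀM = I ⇒ MMᵀ = I`, which in the basis `e_k ⊗ e_a` is the displayed identity
(`TransferIsometry`, stmt-12951, is its diagonal `i = j`, `a' = b'` summed over `a'`). -/
theorem stub_rowOrthonormality : ∀ σ : ℝ, RowOrthonormality σ := by
  sorry

/-- STUB 1 (BALANCE IDENTITY, M, provable now). For `0 < σ ≤ 1/2` (so `ε_N < 1/2`: regular torus
geometry, binary collisions) and every flow family: `Cc = J_N` on the good set, for all `τ ≤ t`.
Tools: `HardSphereFlow.sub_eq_integral_add_collisionalTransfer` / `momentumObservable_sub_eq_torus`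
(time-independent tests) extended to space–time tests (`IsSmoothSpaceTimeOn`: FTC between collision
times for `s ↦ Obs ψ χ N s (Φ_s z)`, the `s`-derivative being the crux's integrand off a finite
set), `collisionalTransfer` = sum of jumps = `collisionPairSum` of `jumpK`
(`collisionJump_momentumObservable/_energyObservable`, `IsHardSphereTrajectory.contactPairs_eq_pair`,
`collisionPairSum_eq_finset_sum`), `empiricalMeasure` weights `(N+1)⁻¹`. -/
theorem stub_balance : ∀ σ : ℝ, 0 < σ → σ ≤ 1 / 2 → ∀ Φ : Flows σ, BalanceFor σ Φ := by
  sorry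

/-- STUB 2 (CONTACT-PAIR CLT ⟹ [A]; load-bearing, hardest, XL). Given row orthonormality of the
transfer: for all nice profiles there is `σ₀ > 0` such that for `0 < σ < σ₀`, IF the rows of the
backward velocity transfer delocalise in local-Gibbs mean on every admissible window (the conclusion
of crux 12950 `DiffuseBackwardInfluence` at `(σ, profiles)`, verbatim) and IF the kinetic fluxes
close (the conclusion of the target 9522 `FastMomentRelaxation`, verbatim — in-route the OUTPUT of
the same engine via crux 12949; it supplies the isotropy of the common ancestor covariance at time
`s − Δ_N` that the cross-row identity needs, triage r1-2 (a)), THEN for every flow family, every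
`t > 0` with a time-averaged exponential velocity moment (9519 (i)), every admissible kernel family
with the density window (9519 (ii)) and all smooth tests, MOMENT CHAOS AT CONTACT [A] holds.
Mechanism (card): `(v_i, v_j)(s_c⁻) = (Σ_k M_ik v_k, Σ_k M_jk v_k)(s_c − Δ_N)` with
`Σ_k M_ik M_jkᵀ = 0`, `Σ_k M_ik M_ikᵀ = 𝟙`; delocalised rows (collision-sampled `ipr → 0`, hence
kinship `K_ij ≤ √(ipr_i ipr_j) → 0`) + kinetic-scale decorrelation of ancestors + Lindeberg along the
backward collision filtration ⇒ the flux-weighted pair law at contact has product second/third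
moments; the `|g·ω|`-bias is the explicit weight, the Taylor step `ψ(x_i) − ψ(x_j) = ε(ω·∇)ψ + O(ε²)`
is priced by the exponential moments. Why it might fail: the forest is velocity-SELECTED (triage X1:
forest-conditioning is not an identity even at equilibrium, where exactness is invariance), so an
`O(1)` tilt of the contact pair law along the non-equilibrium law is not excluded by orthogonality —
the same hidden input as 12949 `AdaptedWeightCLT` (selection enters only through the flux factor);
sub-block structure would break it together with 9522 and the crux. -/
theorem stub_contactPairCLT :
    (∀ σ : ℝ, RowOrthonormality σ) →
    ∀ (a₀ θ₀ : T3 → ℝ) (u₀ : T3 → V3), NiceProfiles a₀ θ₀ u₀ →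
      ∃ σ₀ : ℝ, 0 < σ₀ ∧ ∀ σ : ℝ, 0 < σ → σ < σ₀ →
        DelocAt σ a₀ θ₀ u₀ → FMRAt σ a₀ θ₀ u₀ →
        ∀ (Φ : Flows σ) (t : ℝ), 0 < t → ExpMomAt σ a₀ θ₀ u₀ Φ t →
          ∀ (γ C : ℝ) (φ : ℕ → T3 → ℝ), 0 < γ → γ ≤ 1 / 15 → AdmissibleKernel γ C φ →
            WindowAt σ a₀ θ₀ u₀ Φ t φ →
            ∀ (ψ : ℝ → T3 → V3) (χ : ℝ → T3 → ℝ),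
              Literature.Analysis.FunctionSpaces.Torus.IsSmoothSpaceTimeOn (Icc 0 t) ψ →
              Literature.Analysis.FunctionSpaces.Torus.IsSmoothSpaceTimeOn (Icc 0 t) χ →
              ChaosA σ a₀ θ₀ u₀ Φ φ t ψ χ := by
  sorry

/-- STUB 3 (THERMODYNAMIC CONTACT VALUE [B]; L/XL, configurational, engines outside this card).
For all nice profiles there is `σ₀ > 0` such that for `0 < σ < σ₀`, every flow family, `t > 0`
with exponential velocity moments (9519 (i)), every admissible kernel family with the density window
(9519 (ii)) and all smooth tests, [B] holds:
the time-integrated empirical contact intensity, de-fluxed, is `ρ̄² Y(ρ̄σ³)` with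
`(2π/3) η Y(η) = Z(η) − 1` EXACTLY (all orders in `η = ρ̄σ³`), with isotropic contact normals, on
every block — i.e. `p_N ≈ p_c(ρ̄, θ̄) ds dx` against block-measurable weights. Engines (other
cards of this crux): two-scale stationarity + velocity-moment chaos near contact ⇒ weak hard-core
YBG ⇒ Kirkwood–Salsburg rigidity below Ruelle's radius (`ward-bgy-contact-rigidity` ≈
`ybg-rigidity-contact-value`, ceiling `η_KS ≈ 0.088`), or zero-gradient rigidity of conditional
covariance (`conditional-covariance-liouville-rigidity`), or the identification-free Loschmidt
selection finish (`loschmidt-selection-collisional-channel`). Why it might fail: rattler cages /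
sub-mesoscopic clustering at bounded entropy cost (triage X2, `cage_entropy.out`) — a contact-scale
Ruelle-type bound along the flow is load-bearing and nobody's theorem; `Y` exact needs the pressure
equation for the tree's `limsup` free energy (triage X3). -/
theorem stub_contactValue :
    ∀ (a₀ θ₀ : T3 → ℝ) (u₀ : T3 → V3), NiceProfiles a₀ θ₀ u₀ →
      ∃ σ₀ : ℝ, 0 < σ₀ ∧ ∀ σ : ℝ, 0 < σ → σ < σ₀ →
        ∀ (Φ : Flows σ) (t : ℝ), 0 < t → ExpMomAt σ a₀ θ₀ u₀ Φ t →
          ∀ (γ C : ℝ) (φ : ℕ → T3 → ℝ), 0 < γ → γ ≤ 1 / 15 → AdmissibleKernel γ C φ →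
            WindowAt σ a₀ θ₀ u₀ Φ t φ →
            ∀ (ψ : ℝ → T3 → V3) (χ : ℝ → T3 → ℝ),
              Literature.Analysis.FunctionSpaces.Torus.IsSmoothSpaceTimeOn (Icc 0 t) ψ →
              Literature.Analysis.FunctionSpaces.Torus.IsSmoothSpaceTimeOn (Icc 0 t) χ →
              ValueB σ a₀ θ₀ u₀ Φ φ t ψ χ := by
  sorry

/-- STUB 4 (`(Z−1)`-WEIGHTED WEAK RELAXATION [C] from the route's kinetic closure; M/L, provable
now as an implication). Given Ruelle convexity of the free-energy density (support 9526
`HsFreeEnergyConvex`, by name): for all nice profiles, every `σ > 0` at which the conclusion of the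
target 9522 `FastMomentRelaxation` holds (verbatim), every flow family, `t > 0` with exponential
moments (9519 (i): energy per particle `≤ Cexp/(2λt)` w.h.p.), every admissible kernel family with
the density window (9519 (ii)) and all smooth tests, [C] holds. Proof sketch: on the window event
`c₁ ≤ ρ̄ ≤ σ⁻³`, `kinW · p_c = (Z(ρ̄σ³) − 1)[(2/5)(D:∇ψ + Dū·∇χ) + (3/5) q·∇χ]` with
`|Z − 1| ≤ C_Z` on `[c₁σ³, 1]` (convexity ⇒ local Lipschitz bounds for `ρ ↦ ρ f_ex(ρσ³)` on compacts
of `(0, 1.1σ⁻³)`; deriv-junk `0` is bounded too), `|ū|² ≤ 2Ē/c₁`, Cauchy–Schwarz in `(s, x)`: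
`sup_τ |K_N| ≤ C_Z ‖(ψ,χ)‖_{C¹} [√t (1 + √(2E t/c₁)) ‖D‖_{L²ₜ,ₓ} + √t ‖q‖_{L²ₜ,ₓ}] → 0` by 9522. -/
theorem stub_weightedRelaxation :
    Summit.AtomisticToContinuum.HydrodynamicLimit.Theses.CollisionIsometryCLT.HsFreeEnergyConvex →
    ∀ (a₀ θ₀ : T3 → ℝ) (u₀ : T3 → V3), NiceProfiles a₀ θ₀ u₀ →
      ∀ σ : ℝ, 0 < σ → FMRAt σ a₀ θ₀ u₀ →
        ∀ (Φ : Flows σ) (t : ℝ), 0 < t → ExpMomAt σ a₀ θ₀ u₀ Φ t →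
          ∀ (γ C : ℝ) (φ : ℕ → T3 → ℝ), 0 < γ → γ ≤ 1 / 15 → AdmissibleKernel γ C φ →
            WindowAt σ a₀ θ₀ u₀ Φ t φ →
            ∀ (ψ : ℝ → T3 → V3) (χ : ℝ → T3 → ℝ),
              Literature.Analysis.FunctionSpaces.Torus.IsSmoothSpaceTimeOn (Icc 0 t) ψ →
              Literature.Analysis.FunctionSpaces.Torus.IsSmoothSpaceTimeOn (Icc 0 t) χ →
              RelaxC σ a₀ θ₀ u₀ Φ φ t ψ χ := by
  sorry

/-- STUB 5 (REDUCTION, M, provable now; measure theory). For `0 < σ ≤ 1/2` (local Gibbs laws are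
probability measures, `isProbabilityMeasure_localGibbsLaw`; `localGibbsLaw ≪ Liouville` and the
good set is conull, so [S1] holds almost surely): [S1] ∧ [A] ∧ [B] ∧ [C] (for all `t`, kernels and
tests) ⟹ the crux's conclusion at `(σ, profiles, Φ)`: on the good set
`|Cc − Rhs| ≤ |J − S| + |S − (Rhs + K)| + |K|`, so the bad event at level `δ` is covered by the
three bad events at level `δ/3` and a null set; `measure_union_le`, `Tendsto.add`, and the crux's
`let`s are this file's `Cc`, `Rhs`, `rhoB`, … definitionally. -/
theorem stub_reduction :
    ∀ σ : ℝ, 0 < σ → σ ≤ 1 / 2 → ∀ (a₀ θ₀ : T3 → ℝ) (u₀ : T3 → V3), NiceProfiles a₀ θ₀ u₀ →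
      ∀ Φ : Flows σ, BalanceFor σ Φ →
        (∀ t : ℝ, 0 < t →
          ∀ (γ C : ℝ) (φ : ℕ → T3 → ℝ), 0 < γ → γ ≤ 1 / 15 → AdmissibleKernel γ C φ →
            ∀ (ψ : ℝ → T3 → V3) (χ : ℝ → T3 → ℝ),
              Literature.Analysis.FunctionSpaces.Torus.IsSmoothSpaceTimeOn (Icc 0 t) ψ →
              Literature.Analysis.FunctionSpaces.Torus.IsSmoothSpaceTimeOn (Icc 0 t) χ →
              ChaosA σ a₀ θ₀ u₀ Φ φ t ψ χ) →
        (∀ t : ℝ, 0 < t →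
          ∀ (γ C : ℝ) (φ : ℕ → T3 → ℝ), 0 < γ → γ ≤ 1 / 15 → AdmissibleKernel γ C φ →
            ∀ (ψ : ℝ → T3 → V3) (χ : ℝ → T3 → ℝ),
              Literature.Analysis.FunctionSpaces.Torus.IsSmoothSpaceTimeOn (Icc 0 t) ψ →
              Literature.Analysis.FunctionSpaces.Torus.IsSmoothSpaceTimeOn (Icc 0 t) χ →
              ValueB σ a₀ θ₀ u₀ Φ φ t ψ χ) →
        (∀ t : ℝ, 0 < t →
          ∀ (γ C : ℝ) (φ : ℕ → T3 → ℝ), 0 < γ → γ ≤ 1 / 15 → AdmissibleKernel γ C φ →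
            ∀ (ψ : ℝ → T3 → V3) (χ : ℝ → T3 → ℝ),
              Literature.Analysis.FunctionSpaces.Torus.IsSmoothSpaceTimeOn (Icc 0 t) ψ →
              Literature.Analysis.FunctionSpaces.Torus.IsSmoothSpaceTimeOn (Icc 0 t) χ →
              RelaxC σ a₀ θ₀ u₀ Φ φ t ψ χ) →
        ConclusionAtFlow σ a₀ θ₀ u₀ Φ := by
  sorry

end Holds

/-! ## Stub statements by name (D-0027 §3.3: the hypotheses of `_of` are these `Prop`s) -/

/-- Statement of registered stub 0 (`Holds.stub_rowOrthonormality`), by name. -/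
def stub_rowOrthonormality : Prop := type_of% Holds.stub_rowOrthonormality
/-- Statement of registered stub 1 (`Holds.stub_balance`), by name. -/
def stub_balance : Prop := type_of% Holds.stub_balance
/-- Statement of registered stub 2 (`Holds.stub_contactPairCLT`), by name. -/
def stub_contactPairCLT : Prop := type_of% Holds.stub_contactPairCLT
/-- Statement of registered stub 3 (`Holds.stub_contactValue`), by name. -/
def stub_contactValue : Prop := type_of% Holds.stub_contactValue
/-- Statement of registered stub 4 (`Holds.stub_weightedRelaxation`), by name. -/
def stub_weightedRelaxation : Prop := type_of% Holds.stub_weightedRelaxation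
/-- Statement of registered stub 5 (`Holds.stub_reduction`), by name. -/
def stub_reduction : Prop := type_of% Holds.stub_reduction

/-! ## Composition (sorry-free): route items by name + the six stubs ⟹ the crux BY NAME -/

/-- **The skeleton theorem.** `σ₀ := min (σ_9522, σ_12950, σ_9519, σ_[A], σ_[B], 1/2)`; for
`σ < σ₀` and a flow family `Φ`, stub 5 is fed stub 1 at `(σ, Φ)`, [A] from stub 2 (row
orthonormality from stub 0, delocalisation from `DiffuseBackwardInfluence`, moments and window from
`AprioriBounds`), [B] from stub 3 (window from `AprioriBounds`), [C] from stub 4 (convexity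
`HsFreeEnergyConvex`, closure `FastMomentRelaxation`, moments and window from `AprioriBounds`), and
returns the crux's conclusion at `(σ, profiles, Φ)` — definitionally the crux's `let`-telescope. -/
theorem CollisionalTransferLocality_of
    (hF : Summit.AtomisticToContinuum.HydrodynamicLimit.Theses.CollisionIsometryCLT.FastMomentRelaxation)
    (hD : Summit.AtomisticToContinuum.HydrodynamicLimit.Theses.CollisionIsometryCLT.DiffuseBackwardInfluence)
    (hA : Summit.AtomisticToContinuum.HydrodynamicLimit.Theses.CollisionIsometryCLT.AprioriBounds)
    (hH : Summit.AtomisticToContinuum.HydrodynamicLimit.Theses.CollisionIsometryCLT.HsFreeEnergyConvex)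
    (h0 : stub_rowOrthonormality) (h1 : stub_balance) (h2 : stub_contactPairCLT)
    (h3 : stub_contactValue) (h4 : stub_weightedRelaxation) (h5 : stub_reduction) :
    Summit.AtomisticToContinuum.HydrodynamicLimit.Theses.CollisionIsometryCLT.CollisionalTransferLocality := by
  intro a₀ θ₀ u₀ ha hθ hu ha0 hθ0
  have hP : NiceProfiles a₀ θ₀ u₀ := ⟨ha, hθ, hu, ha0, hθ0⟩
  obtain ⟨σF, hσF, HF⟩ := hF a₀ θ₀ u₀ ha hθ hu ha0 hθ0
  obtain ⟨σD, hσD, HD⟩ := hD a₀ θ₀ u₀ ha hθ hu ha0 hθ0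
  obtain ⟨σA, hσA, HA⟩ := hA a₀ θ₀ u₀ ha hθ hu ha0 hθ0
  have h0' : ∀ σ : ℝ, RowOrthonormality σ := h0
  have h1' : ∀ σ : ℝ, 0 < σ → σ ≤ 1 / 2 → ∀ Φ : Flows σ, BalanceFor σ Φ := h1
  obtain ⟨σ₂, hσ₂, H2⟩ := (h2 : type_of% Holds.stub_contactPairCLT) h0' a₀ θ₀ u₀ hP
  obtain ⟨σ₃, hσ₃, H3⟩ := (h3 : type_of% Holds.stub_contactValue) a₀ θ₀ u₀ hP
  have H4 := (h4 : type_of% Holds.stub_weightedRelaxation) hH a₀ θ₀ u₀ hP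
  have H5 := (h5 : type_of% Holds.stub_reduction)
  refine ⟨min (min (min σF σD) (min σA σ₂)) (min σ₃ (1 / 2)), ?_, ?_⟩
  · exact lt_min (lt_min (lt_min hσF hσD) (lt_min hσA hσ₂)) (lt_min hσ₃ (by norm_num))
  intro σ hσ hlt
  have hltF : σ < σF := lt_of_lt_of_le hlt
    ((min_le_left _ _).trans ((min_le_left _ _).trans (min_le_left _ _)))
  have hltD : σ < σD := lt_of_lt_of_le hlt
    ((min_le_left _ _).trans ((min_le_left _ _).trans (min_le_right _ _)))
  have hltA : σ < σA := lt_of_lt_of_le hlt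
    ((min_le_left _ _).trans ((min_le_right _ _).trans (min_le_left _ _)))
  have hlt2 : σ < σ₂ := lt_of_lt_of_le hlt
    ((min_le_left _ _).trans ((min_le_right _ _).trans (min_le_right _ _)))
  have hlt3 : σ < σ₃ := lt_of_lt_of_le hlt ((min_le_right _ _).trans (min_le_left _ _))
  have hhalf : σ ≤ 1 / 2 := (lt_of_lt_of_le hlt ((min_le_right _ _).trans (min_le_right _ _))).le
  have hDel : DelocAt σ a₀ θ₀ u₀ := HD σ hσ hltD
  have hFm : FMRAt σ a₀ θ₀ u₀ := HF σ hσ hltF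
  have hAp := HA σ hσ hltA
  intro Φ
  exact H5 σ hσ hhalf a₀ θ₀ u₀ hP Φ (h1' σ hσ hhalf Φ)
    (fun t ht γ C φ hγ hγ' hadm ψ χ hψ hχ =>
      H2 σ hσ hlt2 hDel hFm Φ t ht (hAp Φ t ht).1 γ C φ hγ hγ' hadm
        ((hAp Φ t ht).2 γ C φ hγ hγ' hadm) ψ χ hψ hχ)
    (fun t ht γ C φ hγ hγ' hadm ψ χ hψ hχ =>
      H3 σ hσ hlt3 Φ t ht (hAp Φ t ht).1 γ C φ hγ hγ' hadm
        ((hAp Φ t ht).2 γ C φ hγ hγ' hadm) ψ χ hψ hχ)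
    (fun t ht γ C φ hγ hγ' hadm ψ χ hψ hχ =>
      H4 σ hσ hFm Φ t ht (hAp Φ t ht).1 γ C φ hγ hγ' hadm
        ((hAp Φ t ht).2 γ C φ hγ hγ' hadm) ψ χ hψ hχ)

/-- **The shared twin.** The crux is SHARED VERBATIM with route `StiffCollisionalRelaxation` (its K2,
rank 3; the two decls are `rfl`-equal, Disproof `shared_verbatim`), and so are 9522, 9519 and 9526; the
same composition therefore concludes the Stiff copy BY NAME (the ledger resolves the crux item to
whichever route listed it first). `DiffuseBackwardInfluence` (12950) exists only in
`CollisionIsometryCLT` and enters as that route's item. -/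
theorem CollisionalTransferLocality_twin_of
    (hF : Summit.AtomisticToContinuum.HydrodynamicLimit.Theses.StiffCollisionalRelaxation.FastMomentRelaxation)
    (hD : Summit.AtomisticToContinuum.HydrodynamicLimit.Theses.CollisionIsometryCLT.DiffuseBackwardInfluence)
    (hA : Summit.AtomisticToContinuum.HydrodynamicLimit.Theses.StiffCollisionalRelaxation.AprioriBounds)
    (hH : Summit.AtomisticToContinuum.HydrodynamicLimit.Theses.StiffCollisionalRelaxation.HsFreeEnergyConvex)
    (h0 : stub_rowOrthonormality) (h1 : stub_balance) (h2 : stub_contactPairCLT)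
    (h3 : stub_contactValue) (h4 : stub_weightedRelaxation) (h5 : stub_reduction) :
    Summit.AtomisticToContinuum.HydrodynamicLimit.Theses.StiffCollisionalRelaxation.CollisionalTransferLocality :=
  CollisionalTransferLocality_of hF hD hA hH h0 h1 h2 h3 h4 h5

/-- D-0027 §3.3 shape: the crux from the registered stubs and the four route items — an `example`,
so that `CollisionalTransferLocality_of` stays the unique theorem concluding the crux; it becomes a
proof of the item once the six `sorry`s are discharged and the four items have landed. -/
example
    (hF : Summit.AtomisticToContinuum.HydrodynamicLimit.Theses.CollisionIsometryCLT.FastMomentRelaxation)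
    (hD : Summit.AtomisticToContinuum.HydrodynamicLimit.Theses.CollisionIsometryCLT.DiffuseBackwardInfluence)
    (hA : Summit.AtomisticToContinuum.HydrodynamicLimit.Theses.CollisionIsometryCLT.AprioriBounds)
    (hH : Summit.AtomisticToContinuum.HydrodynamicLimit.Theses.CollisionIsometryCLT.HsFreeEnergyConvex) :
    Summit.AtomisticToContinuum.HydrodynamicLimit.Theses.CollisionIsometryCLT.CollisionalTransferLocality :=
  CollisionalTransferLocality_of hF hD hA hH Holds.stub_rowOrthonormality Holds.stub_balance
    Holds.stub_contactPairCLT Holds.stub_contactValue Holds.stub_weightedRelaxation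
    Holds.stub_reduction

end

end Summit.AtomisticToContinuum.HydrodynamicLimit.Cruxes.CollisionalTransferLocality.ContactChaosByRowOrthogonality
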